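import Summits.QuantumFields.YangMills.Theorems.UnitScaleTiltProp7CornerCombH21ECounts
import Summits.QuantumFields.YangMills.Theorems.UnitScaleTiltProp7CornerCombL1PropagationBoxes
import HarnessLib

/-!
# (n3)-COMB (II), row `hMcomb₂`, H2-1(E) member knit, file M-3 (proper) part 2 «LEVEL-ZERO ROWS» — THE UNTIED, SQUARE-DOMINATED LEVEL-0 SOURCE OF THE `ℓ¹` KNIT ON `ℤ³`,
# IN THE `hZ₀` MONOMIALS OF ✓`Prop7CornerCombH21ERealAssembly.h21E_real_assembly` (currencies extensive ONCE)

Crux `stmt-QuantumFields-19200` `Summit.QuantumFields.YangMills.Theses.UnitScaleTilt.MinimiserStabilityRegPr`, route-R E′ (A′)-on-Σ, P-A2 (β); row `hMcomb₂` ⟸ H2-1(E)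
(★px17 H-3c ✓p714849 ∕ H-4b: `hMcomb₂` ⟸ per-(l, j) `ℓ¹` bounds of the cornered propagators on tied sources + the level-0 defect).  px18 g4 LOCATE «H2-1(E) SUPPLIER — THE MEMBER
KNIT SKELETON OVER THE LANDED ℓ¹ KIT» (19200 evidence 2686e4bb) §2 «M-3»; seam (β) with ★px17 g5 (the MEMBER instantiation at `RegPr` is M-4b, not here); v2 after ★px17 g5's
located `(1 + N_l³)` volume leak (bus 2026-08-29 11:25:01Z): the Λ boxes are priced with the UNIFORM big box `Rb := s·(L+4)` (`s` = corner spacing) and counted over the corner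
FAMILY with bounded multiplicity (✓F-6d-1), so every currency is extensive ONCE.  Cell `ym3-torus`, width seat `ym-ust-20520-w3` (gen 12);
`--kind proof --supports stmt-QuantumFields-19200 --as helper`; THEOREMS ONLY (0 `def`, 0 `sorry`); «(O2) groundwork»; count-neutral.

THE POINT.  The level-0 term of H-4b's Duhamel row is the cornered tower `P_{l←0}` of `E_0 = e^{(iX)♯} − 1 − (iX)♯`, a source SQUARE-DOMINATED by the `N₀`-periodic field
`X♯` (`‖E_0 x μ‖ ≤ c₀·‖X♯ x μ‖²`), not tied.  ✓C ★★★`Prop7CornerCombL1PropagationBoxes.sum_norm_linTower_le_boxes` (run `n = l` steps) + ✓M-2 §1 (straight box at `A := 9`) +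
✓D §2 `sum_sq_norm_box_le_localisedMass_normGap` at the UNIFORM big radius `Rb₀ := Lⁿ·(L+4)` with part 0's corner-family count (★★ `lambda_level_sq_le`) give EXACTLY the `hZ₀`
shape of ✓`h21E_real_assembly` at `M := Σ_{cell}Σ_ν‖X♯‖²`, `G₀ := Σ_{cell}Σ_νΣ_μ(‖X♯(·+e_μ) ν‖ − ‖X♯ · ν‖)²`, constant slots `cS ≥ 729·c₀`, `cΛ ≥ 288·L·(2L+9)³·c₀`, `V ≥ 1`,
`V′ ≥ 13068(L+4)²` (`N₀ = N_l·Lⁿ`, reading set `box c R`, `2R+1 ≤ 2N_l`).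

WHAT IS PROVED (ns `…Theorems.Prop7CornerCombH21ELevelZeroRows`): ★★ `lambda_level_sq_le`, ★★ `sum_norm_linTower_sq_le_rows` (✓C's binders VERBATIM + square domination +
periodicity + cell geometry + window product row + four constant slots ⟹ the two-monomial bound).  Decl-local heartbeat budgets 400000 on both (README HEARTBEAT rule).

HONEST SCOPE.  Finite-sum ∕ real-inequality bookkeeping over landed and signed rows; every analytic input is a displayed hypothesis.  Nothing of H2-1's member,
`hMcomb₂`, `hMcomb`, (G_j), (β), `hD`, EX `stub_existenceMinimalOrbit`, the crux `MinimiserStabilityRegPr`, or any summit statement is proved or claimed here.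
YM₃ on T³ is ladder rung R3 (HUMAN RULING D-0037) — NOT d = 4, NOT infinite volume, NOT a mass gap, NOT the Clay problem; the YM mass gap is NOT proved.

References: T. Bałaban, «Averaging operations for lattice gauge theories», CMP **98** (1985) 17–51 [Balaban1985Averaging] ((2) p.17, (42)–(43) pp.23–24, (124)–(126) p.36);
T. Bałaban, «The variational problem and background fields in renormalization group method for lattice gauge theories», CMP **102** (1985) 277–309 [Balaban1985Variational] (Prop. 7 p.299);
M. Giaquinta, *Multiple integrals in the calculus of variations and nonlinear elliptic systems* (1983) [Giaquinta1984] (Ch. III §1 pp.64–72).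
-/

set_option autoImplicit false

noncomputable section

open scoped BigOperators
open Finset

namespace Summit.QuantumFields.YangMills.Theorems.Prop7CornerCombH21ELevelZeroRows

open NormedSpace
open Literature.MathematicalPhysics.QuantumFieldTheory.Balaban1983to89
open ExpMeanLog (eml)
open B7Prop1Explicit (Site Letter e seg treeWord boxVec gammaWord Wcx Xavg bavg expUnit U1)
open B7Prop2Explicit (avgIter unitaryUnits)
open B7Prop3GeneralRotated (tsum)
open B4Eq19LatticeOperators (box card_box)
open Summit.QuantumFields.YangMills.Theorems.Prop7CornerCombH21ECounts (rad_nonneg rad_le ratio_pow_le pow_ratio_succ sum_box_sum_box_le_cell)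
open Summit.QuantumFields.YangMills.Theorems.Prop7CornerCombL1PropagationBoxes (sum_norm_linTower_le_boxes)
open Summit.QuantumFields.YangMills.Theorems.Prop7CornerCombTiedSourceBoxes (sum_sq_norm_box_le_localisedMass_normGap)
open Summit.QuantumFields.YangMills.Theorems.Prop7CornerCombH21ELambdaPricing (sum_box_le_pow_mul_sum_cell_of_periodic)

/-! ## §2 The level-0 (untied, square-dominated) source: the Λ boxes with the uniform big box and the corner-family count, then the level row (`d = 3`) -/

section Untied

variable {d : ℕ} {𝔸 : Type*} [CStarAlgebra 𝔸] [Nontrivial 𝔸] {𝔅 : Type*} [SeminormedAddCommGroup 𝔅]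

omit [Nontrivial 𝔸] in
-- hb 400000: six nested `Finset` sums per corner + ✓D §2's Hardy row instantiated twice per level; measured > 100k.
set_option maxHeartbeats 400000 in
/-- ★★ **THE Λ BOXES OF ONE SAMPLING LEVEL FOR A SQUARE-DOMINATED SOURCE, PRICED WITHOUT VOLUME FACTOR** (`d = 3`, `2 ≤ L`, `i < n`).  For a source `Y` with
`‖Y x μ‖ ≤ c₀·‖X♯ x μ‖²`, `X♯` `N`-periodic with `N = N_l·Lⁿ`, and corners `z ∈ box c R` (`2R+1 ≤ 2N_l`), the reading boxes `box (Lⁿ•z) ρᵢ`, `box (Lⁿ•(z+e_κ)) ρᵢ` are priced by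
✓D §2 `sum_sq_norm_box_le_localisedMass_normGap` with the UNIFORM big radius `Rb₀ := Lⁿ·(L+4)` (`t := 1`) and counted over the corner FAMILY by ★`sum_box_sum_box_le_cell`:
`Σ_{z}Σ_κ[…] ≤ 96·c₀·(2L+9)³·((L³)^(i+1)·((L³)^(n+1))⁻¹·Σ_{cell}Σ_ν‖X♯‖² + 13068·(L+4)²·(L²)^(i+1)·Σ_{cell}Σ_νΣ_μ(‖X♯(·+e_μ) ν‖ − ‖X♯ · ν‖)²)`.
[cite: Balaban1985Averaging, (124)-(126) p.36] -/
theorem lambda_level_sq_le (hd : d = 3) (L : ℕ) (hL : 2 ≤ L) {n i : ℕ} (hin : i < n)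
    (Y : Site d → Fin d → 𝔸) (Xf : Site d → Fin d → 𝔅) {c₀ : ℝ} (hc₀ : 0 ≤ c₀)
    (hY : ∀ (x : Site d) (μ : Fin d), ‖Y x μ‖ ≤ c₀ * ‖Xf x μ‖ ^ 2)
    (N : ℕ) [NeZero N] (hper : ∀ (x : Site d) (κ : Fin d), Xf (x + (N : ℤ) • e κ) = Xf x)
    (Nl : ℕ) (hN : N = Nl * L ^ n) (c : Site d) (R : ℕ) (hR : 2 * R + 1 ≤ 2 * Nl) :
    ∑ z ∈ box c (R : ℤ), ∑ κ : Fin d,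
        (∑ x ∈ box (((L : ℤ) ^ n) • z) ((L : ℤ) ^ i * (L + 4) - 4), ∑ μ : Fin d, ‖Y x μ‖ +
          ∑ x ∈ box (((L : ℤ) ^ n) • (z + e κ)) ((L : ℤ) ^ i * (L + 4) - 4), ∑ μ : Fin d, ‖Y x μ‖)
      ≤ 96 * c₀ * (2 * (L : ℝ) + 9) ^ 3 *
          (((L : ℝ) ^ 3) ^ (i + 1) * (((L : ℝ) ^ 3) ^ (n + 1))⁻¹ * (∑ y : Fin d → Fin N, ∑ ν : Fin d, ‖Xf (boxVec N y) ν‖ ^ 2)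
            + 13068 * ((L : ℝ) + 4) ^ 2 * ((L : ℝ) ^ 2) ^ (i + 1) *
                (∑ y : Fin d → Fin N, ∑ ν : Fin d, ∑ μ : Fin d, (‖Xf (boxVec N y + e μ) ν‖ - ‖Xf (boxVec N y) ν‖) ^ 2)) := by
  subst hd
  set M : ℝ := ∑ y : Fin 3 → Fin N, ∑ ν : Fin 3, ‖Xf (boxVec N y) ν‖ ^ 2 with hM
  set G : ℝ := ∑ y : Fin 3 → Fin N, ∑ ν : Fin 3, ∑ μ : Fin 3, (‖Xf (boxVec N y + e μ) ν‖ - ‖Xf (boxVec N y) ν‖) ^ 2 with hG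
  have hM0 : 0 ≤ M := by positivity
  have hG0 : 0 ≤ G := by positivity
  have hL1 : 1 ≤ L := by omega
  have hL0 : (0 : ℝ) < L := by exact_mod_cast (show 0 < L by omega)
  have hNl : 1 ≤ Nl := by
    rcases Nat.eq_zero_or_pos Nl with h | h
    · subst h; simp at hN; exact absurd hN (NeZero.ne N)
    · exact h
  haveI : NeZero Nl := ⟨by omega⟩
  -- the radius letters
  set ρ : ℤ := (L : ℤ) ^ i * (L + 4) - 4 with hρdef
  have hρ0 : 0 ≤ ρ := rad_nonneg L hL1 i
  have hρr : ((ρ : ℤ) : ℝ) = (L : ℝ) ^ i * (L + 4) - 4 := by rw [hρdef]; push_cast; ring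
  obtain ⟨hr2, hr1, hr3⟩ := rad_le L hL1 hin.le
  rw [← hρr] at hr2 hr1 hr3
  have hρr0 : (0 : ℝ) ≤ ((ρ : ℤ) : ℝ) := by exact_mod_cast hρ0
  -- the uniform big box
  set Rb : ℕ := L ^ n * (L + 4) with hRb
  have hRbr : ((Rb : ℕ) : ℝ) = (L : ℝ) ^ n * (L + 4) := by rw [hRb]; push_cast; ring
  have hRint : ρ ≤ ((Rb : ℕ) : ℤ) := by
    have : ((ρ : ℤ) : ℝ) ≤ ((Rb : ℕ) : ℝ) := by rw [hRbr]; exact hr3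
    exact_mod_cast this
  have hA : 2 * (L ^ n * (L + 4)) + 1 ≤ (2 * L + 9) * L ^ n := by
    have : 1 ≤ L ^ n := Nat.one_le_pow _ _ hL1
    nlinarith
  -- the volume ratio
  have hrat : ((((2 * ρ + 1 : ℤ) : ℝ)) ^ 3) / ((((2 * ((Rb : ℕ) : ℤ) + 1 : ℤ) : ℝ)) ^ 3)
      ≤ ((L : ℝ) ^ 3) ^ (i + 1) * (((L : ℝ) ^ 3) ^ (n + 1))⁻¹ := by
    have e1 : (((2 * ρ + 1 : ℤ) : ℝ)) = 2 * ((ρ : ℤ) : ℝ) + 1 := by push_cast; ring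
    have e2 : (((2 * ((Rb : ℕ) : ℤ) + 1 : ℤ) : ℝ)) = 2 * ((Rb : ℕ) : ℝ) + 1 := by push_cast; ring
    rw [e1, e2, ← pow_ratio_succ hL0.ne' n i]
    refine ratio_pow_le hL0 (by linarith) hr2 ?_
    rw [hRbr]; linarith
  have hrat0 : 0 ≤ ((((2 * ρ + 1 : ℤ) : ℝ)) ^ 3) / ((((2 * ((Rb : ℕ) : ℤ) + 1 : ℤ) : ℝ)) ^ 3) := by
    have e1 : (0 : ℝ) ≤ (((2 * ρ + 1 : ℤ) : ℝ)) := by push_cast; linarith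
    positivity
  -- the gap weight `(ρ + 1)² ≤ (L+4)²·(L²)^(i+1)`
  have hgw : (((ρ : ℤ) : ℝ) + 1) ^ 2 ≤ ((L : ℝ) + 4) ^ 2 * ((L : ℝ) ^ 2) ^ (i + 1) := by
    have hL1r : (1 : ℝ) ≤ L := by exact_mod_cast hL1
    have hst : ((L : ℝ) + 4) * (L : ℝ) ^ i ≤ ((L : ℝ) + 4) * (L : ℝ) ^ (i + 1) :=
      mul_le_mul_of_nonneg_left (pow_le_pow_right₀ hL1r (Nat.le_succ i)) (by linarith)
    calc (((ρ : ℤ) : ℝ) + 1) ^ 2 ≤ (((L : ℝ) + 4) * (L : ℝ) ^ (i + 1)) ^ 2 := pow_le_pow_left₀ (by linarith) (hr1.trans hst) 2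
      _ = ((L : ℝ) + 4) ^ 2 * ((L : ℝ) ^ 2) ^ (i + 1) := by rw [← pow_mul, mul_comm 2 (i + 1), pow_mul]; ring
  -- square domination on any box
  have hdom : ∀ (q : Site 3) (r : ℤ), ∑ x ∈ box q r, ∑ μ : Fin 3, ‖Y x μ‖ ≤ c₀ * ∑ x ∈ box q r, ∑ μ : Fin 3, ‖Xf x μ‖ ^ 2 := by
    intro q r
    rw [Finset.mul_sum]
    refine Finset.sum_le_sum fun x _ => ?_
    rw [Finset.mul_sum]
    exact Finset.sum_le_sum fun μ _ => hY x μ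
  -- ✓D §2 per corner (`t := 1`), centre = the dilated corner `Lⁿ•w`
  have ecent : ∀ w : Site 3, ((L : ℤ) ^ n) • w = ((L ^ n : ℕ) : ℤ) • w := fun w => by push_cast; rfl
  have hD : ∀ (w : Site 3), ∑ x ∈ box (((L : ℤ) ^ n) • w) ρ, ∑ μ : Fin 3, ‖Y x μ‖ ≤
      c₀ * ((1 + 1) * (((((2 * ρ + 1 : ℤ) : ℝ)) ^ 3) / ((((2 * ((Rb : ℕ) : ℤ) + 1 : ℤ) : ℝ)) ^ 3)) *
          ∑ x ∈ box (((L ^ n : ℕ) : ℤ) • w) ((Rb : ℕ) : ℤ), ∑ ν : Fin 3, ‖Xf x ν‖ ^ 2 +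
        (1 + 1 / 1) * 13068 * (((ρ : ℤ) : ℝ) + 1) ^ 2 *
          ∑ x ∈ box (((L ^ n : ℕ) : ℤ) • w) ((Rb : ℕ) : ℤ), ∑ ν : Fin 3, ∑ μ : Fin 3, (‖Xf (x + e μ) ν‖ - ‖Xf x ν‖) ^ 2) := by
    intro w
    have h := sum_sq_norm_box_le_localisedMass_normGap rfl Xf (((L : ℤ) ^ n) • w) hρ0 hRint one_pos
    rw [card_box _ hρ0, card_box _ (by positivity : (0 : ℤ) ≤ ((Rb : ℕ) : ℤ)), ecent w] at h
    rw [ecent w]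
    exact (hdom _ _).trans (mul_le_mul_of_nonneg_left h hc₀)
  -- the corner-family counts (`A := 2L+9`, `r := L+4`, `s := Lⁿ`)
  have hRbeq : ((Rb : ℕ) : ℤ) = ((L ^ n * (L + 4) : ℕ) : ℤ) := by rw [hRb]
  have hf0 : ∀ y : Site 3, 0 ≤ ∑ ν : Fin 3, ‖Xf y ν‖ ^ 2 := fun y => by positivity
  have hfp : ∀ (y : Site 3) (κ : Fin 3), ∑ ν : Fin 3, ‖Xf (y + (N : ℤ) • e κ) ν‖ ^ 2 = ∑ ν : Fin 3, ‖Xf y ν‖ ^ 2 := fun y κ => by rw [hper]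
  have hg0 : ∀ y : Site 3, 0 ≤ ∑ ν : Fin 3, ∑ μ : Fin 3, (‖Xf (y + e μ) ν‖ - ‖Xf y ν‖) ^ 2 := fun y => by positivity
  have hgp : ∀ (y : Site 3) (κ : Fin 3),
      ∑ ν : Fin 3, ∑ μ : Fin 3, (‖Xf (y + (N : ℤ) • e κ + e μ) ν‖ - ‖Xf (y + (N : ℤ) • e κ) ν‖) ^ 2
        = ∑ ν : Fin 3, ∑ μ : Fin 3, (‖Xf (y + e μ) ν‖ - ‖Xf y ν‖) ^ 2 := fun y κ => by
    refine Finset.sum_congr rfl fun ν _ => Finset.sum_congr rfl fun μ _ => ?_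
    rw [add_right_comm, hper, hper]
  have hcountM : ∀ v : Site 3, ∑ z ∈ box c (R : ℤ), ∑ x ∈ box (((L ^ n : ℕ) : ℤ) • (z + v)) ((Rb : ℕ) : ℤ), ∑ ν : Fin 3, ‖Xf x ν‖ ^ 2
      ≤ (2 : ℝ) ^ 3 * (((2 * L + 9 : ℕ) : ℝ) ^ 3 * M) := fun v => by
    have h := sum_box_sum_box_le_cell Nl (L ^ n) (L + 4) (2 * L + 9) (Nat.one_le_pow _ _ hL1) hA N hN
      (fun y => ∑ ν : Fin 3, ‖Xf y ν‖ ^ 2) hf0 hfp c R hR v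
    rw [hRbeq]; simpa only [hM] using h
  have hcountG : ∀ v : Site 3, ∑ z ∈ box c (R : ℤ), ∑ x ∈ box (((L ^ n : ℕ) : ℤ) • (z + v)) ((Rb : ℕ) : ℤ),
      ∑ ν : Fin 3, ∑ μ : Fin 3, (‖Xf (x + e μ) ν‖ - ‖Xf x ν‖) ^ 2 ≤ (2 : ℝ) ^ 3 * (((2 * L + 9 : ℕ) : ℝ) ^ 3 * G) := fun v => by
    have h := sum_box_sum_box_le_cell Nl (L ^ n) (L + 4) (2 * L + 9) (Nat.one_le_pow _ _ hL1) hA N hN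
      (fun y => ∑ ν : Fin 3, ∑ μ : Fin 3, (‖Xf (y + e μ) ν‖ - ‖Xf y ν‖) ^ 2) hg0 hgp c R hR v
    rw [hRbeq]; simpa only [hG] using h
  -- abbreviations for the per-corner prices
  set rat : ℝ := ((((2 * ρ + 1 : ℤ) : ℝ)) ^ 3) / ((((2 * ((Rb : ℕ) : ℤ) + 1 : ℤ) : ℝ)) ^ 3) with hratdef
  set Gw : ℝ := (1 + 1 / 1) * 13068 * (((ρ : ℤ) : ℝ) + 1) ^ 2 with hGw
  have hGw0 : 0 ≤ Gw := by rw [hGw]; positivity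
  set MB : Site 3 → ℝ := fun w => ∑ x ∈ box (((L ^ n : ℕ) : ℤ) • w) ((Rb : ℕ) : ℤ), ∑ ν : Fin 3, ‖Xf x ν‖ ^ 2 with hMB
  set GB : Site 3 → ℝ := fun w => ∑ x ∈ box (((L ^ n : ℕ) : ℤ) • w) ((Rb : ℕ) : ℤ),
      ∑ ν : Fin 3, ∑ μ : Fin 3, (‖Xf (x + e μ) ν‖ - ‖Xf x ν‖) ^ 2 with hGB
  have hD' : ∀ w : Site 3, ∑ x ∈ box (((L : ℤ) ^ n) • w) ρ, ∑ μ : Fin 3, ‖Y x μ‖ ≤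
      c₀ * ((1 + 1) * rat) * MB w + c₀ * Gw * GB w := by
    intro w
    have h := hD w
    have e : c₀ * ((1 + 1) * rat * MB w + Gw * GB w) = c₀ * ((1 + 1) * rat) * MB w + c₀ * Gw * GB w := by ring
    rw [← e]; exact h
  -- the corner term and the neighbour term, summed over the corners
  set Bsum : ℝ := c₀ * ((1 + 1) * rat) * ((2 : ℝ) ^ 3 * (((2 * L + 9 : ℕ) : ℝ) ^ 3 * M))
      + c₀ * Gw * ((2 : ℝ) ^ 3 * (((2 * L + 9 : ℕ) : ℝ) ^ 3 * G)) with hBsum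
  have hc1 : 0 ≤ c₀ * ((1 + 1) * rat) := by positivity
  have hc2 : 0 ≤ c₀ * Gw := by positivity
  have hcorner : ∀ v : Site 3, ∑ z ∈ box c (R : ℤ), ∑ x ∈ box (((L : ℤ) ^ n) • (z + v)) ρ, ∑ μ : Fin 3, ‖Y x μ‖ ≤ Bsum := by
    intro v
    have hM' := hcountM v
    have hG' := hcountG v
    calc ∑ z ∈ box c (R : ℤ), ∑ x ∈ box (((L : ℤ) ^ n) • (z + v)) ρ, ∑ μ : Fin 3, ‖Y x μ‖
        ≤ ∑ z ∈ box c (R : ℤ), (c₀ * ((1 + 1) * rat) * MB (z + v) + c₀ * Gw * GB (z + v)) :=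
          Finset.sum_le_sum fun z _ => hD' (z + v)
      _ = c₀ * ((1 + 1) * rat) * ∑ z ∈ box c (R : ℤ), MB (z + v) + c₀ * Gw * ∑ z ∈ box c (R : ℤ), GB (z + v) := by
          rw [Finset.sum_add_distrib, Finset.mul_sum, Finset.mul_sum]
      _ ≤ Bsum := add_le_add (mul_le_mul_of_nonneg_left hM' hc1) (mul_le_mul_of_nonneg_left hG' hc2)
  have hsum1 : ∑ z ∈ box c (R : ℤ), ∑ x ∈ box (((L : ℤ) ^ n) • z) ρ, ∑ μ : Fin 3, ‖Y x μ‖ ≤ Bsum := by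
    have h := hcorner 0
    simpa only [add_zero] using h
  have hsplit : ∑ z ∈ box c (R : ℤ), ∑ κ : Fin 3,
        (∑ x ∈ box (((L : ℤ) ^ n) • z) ρ, ∑ μ : Fin 3, ‖Y x μ‖ + ∑ x ∈ box (((L : ℤ) ^ n) • (z + e κ)) ρ, ∑ μ : Fin 3, ‖Y x μ‖)
      = 3 * ∑ z ∈ box c (R : ℤ), ∑ x ∈ box (((L : ℤ) ^ n) • z) ρ, ∑ μ : Fin 3, ‖Y x μ‖
        + ∑ κ : Fin 3, ∑ z ∈ box c (R : ℤ), ∑ x ∈ box (((L : ℤ) ^ n) • (z + e κ)) ρ, ∑ μ : Fin 3, ‖Y x μ‖ := by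
    rw [Finset.sum_comm (s := Finset.univ) (t := box c (R : ℤ))
      (f := fun κ z => ∑ x ∈ box (((L : ℤ) ^ n) • (z + e κ)) ρ, ∑ μ : Fin 3, ‖Y x μ‖)]
    rw [Finset.mul_sum, ← Finset.sum_add_distrib]
    refine Finset.sum_congr rfl fun z _ => ?_
    rw [Finset.sum_add_distrib, Finset.sum_const, Finset.card_univ, Fintype.card_fin]
    simp
  rw [hsplit]
  have h3 : ∑ κ : Fin 3, ∑ z ∈ box c (R : ℤ), ∑ x ∈ box (((L : ℤ) ^ n) • (z + e κ)) ρ, ∑ μ : Fin 3, ‖Y x μ‖ ≤ 3 * Bsum := by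
    have h := Finset.sum_le_sum fun κ (_ : κ ∈ (Finset.univ : Finset (Fin 3))) => hcorner (e κ)
    have e3 : ∑ _κ : Fin 3, Bsum = 3 * Bsum := by
      rw [Finset.sum_const, Finset.card_univ, Fintype.card_fin, nsmul_eq_mul]; norm_num
    linarith [h, e3.le, e3.ge]
  have htot : 3 * ∑ z ∈ box c (R : ℤ), ∑ x ∈ box (((L : ℤ) ^ n) • z) ρ, ∑ μ : Fin 3, ‖Y x μ‖
        + ∑ κ : Fin 3, ∑ z ∈ box c (R : ℤ), ∑ x ∈ box (((L : ℤ) ^ n) • (z + e κ)) ρ, ∑ μ : Fin 3, ‖Y x μ‖ ≤ 6 * Bsum := by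
    linarith [hsum1, h3]
  refine htot.trans ?_
  -- the monomials
  have e : 6 * Bsum = 96 * c₀ * (2 * (L : ℝ) + 9) ^ 3 * (rat * M + (13068 * (((ρ : ℤ) : ℝ) + 1) ^ 2) * G) := by
    simp only [hBsum, hGw]; push_cast; ring
  rw [e]
  have hK : 0 ≤ 96 * c₀ * (2 * (L : ℝ) + 9) ^ 3 := by positivity
  refine mul_le_mul_of_nonneg_left ?_ hK
  have p1 := mul_le_mul_of_nonneg_right hrat hM0
  have p2 : (13068 * (((ρ : ℤ) : ℝ) + 1) ^ 2) * G ≤ 13068 * ((L : ℝ) + 4) ^ 2 * ((L : ℝ) ^ 2) ^ (i + 1) * G := by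
    have := mul_le_mul_of_nonneg_right (mul_le_mul_of_nonneg_left hgw (by norm_num : (0:ℝ) ≤ 13068)) hG0
    linarith [this]
  simpa only [hratdef] using add_le_add p1 p2

-- hb 400000: large displayed binders (the written-out cornered tower recursion) + instantiation of ✓C and the level row; measured > 100k.
set_option maxHeartbeats 400000 in
/-- ★★ **THE LEVEL-0 SOURCE OF THE H2-1(E) KNIT, IN THE REAL-ASSEMBLY MONOMIALS** (`d = 3`, `2 ≤ L`; v2 — NO volume factor in the norm-gap currency).
Hypotheses: those of ✓C ★★★`Prop7CornerCombL1PropagationBoxes.sum_norm_linTower_le_boxes` VERBATIM (background tower, the cornered linearised tower `Q` of a source `Y` run for `n`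
steps); the source is SQUARE-DOMINATED by an `N`-periodic field `X♯`: `‖Y x μ‖ ≤ c₀·‖X♯ x μ‖²` (the level-0 defect `E_0 = e^{(iX)♯} − 1 − (iX)♯` of H-4b), `N = N_l·Lⁿ`; reading set
`box c R`, `2R + 1 ≤ 2N_l`; the window product row; constant slots `cS ≥ 729·c₀`, `cΛ ≥ 288·L·(2L+9)³·c₀`, `V ≥ 1`, `V′ ≥ 13068(L+4)²`.  CONCLUSION — exactly the `hZ₀` shape of
✓`h21E_real_assembly` (with `l := n`) at `M := Σ_{cell}Σ_ν‖X♯‖²`, `G₀ := Σ_{cell}Σ_νΣ_μ(‖X♯(·+e_μ) ν‖ − ‖X♯ · ν‖)²` (extensive ONCE):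
`Σ_{z∈box c R}Σ_κ‖Q n Y z κ‖ ≤ E·((L²)^n)⁻¹·cS·M + Σ_{i<n} E·((L²)^i)⁻¹·cΛ·(V·(L³)^(i+1)·((L³)^(n+1))⁻¹·M + V′·(L²)^(i+1)·G₀)`.
PROOF: ✓C; straight box by ✓M-2 §1 at `A := 9`; the Λ-part by ★★`lambda_level_sq_le`. «(O2) groundwork.»
[cite: Balaban1985Averaging, (42)-(43) pp.23-24, (124)-(126) p.36] -/
theorem sum_norm_linTower_sq_le_rows (hd : d = 3) (L : ℕ) (hL : 2 ≤ L) (U₀ : Site d → Fin d → 𝔸ˣ) (n : ℕ)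
    (hV : ∀ k, k ≤ n → ∀ (x : Site d) (μ : Fin d), avgIter L U₀ k x μ ∈ unitaryUnits 𝔸)
    (α : ℕ → ℝ) (hα0 : ∀ k, 0 ≤ α k)
    (hα : ∀ k, k < n → ∀ (z : Site d) (κ : Fin d) (r : Fin d → Fin L),
      ‖((Wcx L (avgIter L U₀ k) ((L : ℤ) • z) κ (boxVec L r) : 𝔸ˣ) : 𝔸) - 1‖ ≤ α k)
    (hα24 : ∀ k, k < n → α k ≤ 1 / 24)
    (Y : Site d → Fin d → 𝔸) (Q : ℕ → (Site d → Fin d → 𝔸) → Site d → Fin d → 𝔸) (hQ0 : Q 0 Y = Y)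
    (hQs : ∀ (k : ℕ) (z : Site d) (κ : Fin d), Q (k + 1) Y z κ
      = fderiv ℂ (eml : ((Fin d → Fin L) → 𝔸) → 𝔸) (fun r => ((Wcx L (avgIter L U₀ k) ((L : ℤ) • z) κ (boxVec L r) : 𝔸ˣ) : 𝔸))
            (fun r => tsum (avgIter L U₀ k) (Q k Y) ((L : ℤ) • z) (gammaWord L κ (boxVec L r) ++ seg κ (-(L : ℤ)))
              * ((Wcx L (avgIter L U₀ k) ((L : ℤ) • z) κ (boxVec L r) : 𝔸ˣ) : 𝔸))
            * (((expUnit (Xavg L (avgIter L U₀ k) ((L : ℤ) • z) κ))⁻¹ : 𝔸ˣ) : 𝔸)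
          + ((expUnit (Xavg L (avgIter L U₀ k) ((L : ℤ) • z) κ) : 𝔸ˣ) : 𝔸) * tsum (avgIter L U₀ k) (Q k Y) ((L : ℤ) • z) (seg κ (L : ℤ))
            * (((expUnit (Xavg L (avgIter L U₀ k) ((L : ℤ) • z) κ))⁻¹ : 𝔸ˣ) : 𝔸))
    (Xf : Site d → Fin d → 𝔅) {c₀ : ℝ} (hc₀ : 0 ≤ c₀) (hY : ∀ (x : Site d) (μ : Fin d), ‖Y x μ‖ ≤ c₀ * ‖Xf x μ‖ ^ 2)
    (N : ℕ) [NeZero N] (hper : ∀ (x : Site d) (κ : Fin d), Xf (x + (N : ℤ) • e κ) = Xf x)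
    (Nl : ℕ) (hN : N = Nl * L ^ n) (c : Site d) (R : ℕ) (hR : 2 * R + 1 ≤ 2 * Nl)
    {E : ℝ} (hE : 0 ≤ E)
    (hprod : ∀ i, i ≤ n →
      ∏ m ∈ Finset.range i, ((L : ℝ) * ((L : ℝ) ^ d)⁻¹ + 2 * d * (210 * α m * ((2 * d + 2) * L))) ≤ E * (((L : ℝ) ^ 2) ^ i)⁻¹)
    {cS cΛ V V' : ℝ} (hcS : 729 * c₀ ≤ cS) (hcΛ : 288 * (L : ℝ) * (2 * (L : ℝ) + 9) ^ 3 * c₀ ≤ cΛ) (hVc : 1 ≤ V)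
    (hV'c : 13068 * ((L : ℝ) + 4) ^ 2 ≤ V') :
    ∑ z ∈ box c (R : ℤ), ∑ κ : Fin d, ‖Q n Y z κ‖ ≤
      E * (((L : ℝ) ^ 2) ^ n)⁻¹ * cS * (∑ y : Fin d → Fin N, ∑ ν : Fin d, ‖Xf (boxVec N y) ν‖ ^ 2)
        + ∑ i ∈ Finset.range n, E * (((L : ℝ) ^ 2) ^ i)⁻¹ * cΛ *
            (V * ((L : ℝ) ^ 3) ^ (i + 1) * (((L : ℝ) ^ 3) ^ (n + 1))⁻¹ * (∑ y : Fin d → Fin N, ∑ ν : Fin d, ‖Xf (boxVec N y) ν‖ ^ 2)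
              + V' * ((L : ℝ) ^ 2) ^ (i + 1) *
                (∑ y : Fin d → Fin N, ∑ ν : Fin d, ∑ μ : Fin d, (‖Xf (boxVec N y + e μ) ν‖ - ‖Xf (boxVec N y) ν‖) ^ 2)) := by
  subst hd
  -- letters
  set M : ℝ := ∑ y : Fin 3 → Fin N, ∑ ν : Fin 3, ‖Xf (boxVec N y) ν‖ ^ 2 with hM
  set G : ℝ := ∑ y : Fin 3 → Fin N, ∑ ν : Fin 3, ∑ μ : Fin 3, (‖Xf (boxVec N y + e μ) ν‖ - ‖Xf (boxVec N y) ν‖) ^ 2 with hG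
  have hM0 : 0 ≤ M := by positivity
  have hG0 : 0 ≤ G := by positivity
  have hL1 : 1 ≤ L := by omega
  have hLr : (2 : ℝ) ≤ L := by exact_mod_cast hL
  have hL0 : (0 : ℝ) < L := by linarith
  have hNl : 1 ≤ Nl := by
    rcases Nat.eq_zero_or_pos Nl with h | h
    · subst h; simp at hN; exact absurd hN (NeZero.ne N)
    · exact h
  have hNlr : (1 : ℝ) ≤ Nl := by exact_mod_cast hNl
  have hNcast : (N : ℝ) = Nl * (L : ℝ) ^ n := by rw [hN]; push_cast; ring
  -- ✓C
  have h1 := sum_norm_linTower_le_boxes L hL U₀ n hV α hα0 hα hα24 Y Q hQ0 hQs c (R : ℤ)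
  set w : ℕ → ℝ := fun m => (L : ℝ) * ((L : ℝ) ^ 3)⁻¹ + 2 * (3 : ℕ) * (210 * α m * ((2 * (3 : ℕ) + 2) * L)) with hw
  have hw0 : ∀ m, 0 ≤ w m := fun m =>
    add_nonneg (by positivity) (mul_nonneg (by positivity) (mul_nonneg (mul_nonneg (by norm_num) (hα0 m)) (by positivity)))
  have hWn : ∏ m ∈ Finset.range n, w m ≤ E * (((L : ℝ) ^ 2) ^ n)⁻¹ := hprod n le_rfl
  have hf0 : ∀ y : Site 3, 0 ≤ ∑ ν : Fin 3, ‖Xf y ν‖ ^ 2 := fun y => by positivity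
  have hfp : ∀ (y : Site 3) (κ : Fin 3), ∑ ν : Fin 3, ‖Xf (y + (N : ℤ) • e κ) ν‖ ^ 2 = ∑ ν : Fin 3, ‖Xf y ν‖ ^ 2 :=
    fun y κ => by rw [hper]
  -- square domination on any box
  have hdom : ∀ (q : Site 3) (r : ℤ), ∑ x ∈ box q r, ∑ μ : Fin 3, ‖Y x μ‖ ≤ c₀ * ∑ x ∈ box q r, ∑ μ : Fin 3, ‖Xf x μ‖ ^ 2 := by
    intro q r
    rw [Finset.mul_sum]
    refine Finset.sum_le_sum fun x _ => ?_
    rw [Finset.mul_sum]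
    exact Finset.sum_le_sum fun μ _ => hY x μ
  -- §A the straight big box, folded at `A := 9`
  have hbig : ∑ x ∈ box (((L : ℤ) ^ n) • c) ((L : ℤ) ^ n * (R + 4) - 4), ∑ ν : Fin 3, ‖Y x ν‖ ≤ c₀ * ((9 : ℝ) ^ 3 * M) := by
    have hP : 4 ≤ L ^ n * (R + 4) := le_mul_of_one_le_of_le (Nat.one_le_pow _ _ hL1) (by omega)
    set R' : ℕ := L ^ n * (R + 4) - 4 with hR'
    have hcast : ((R' : ℕ) : ℤ) = (L : ℤ) ^ n * (R + 4) - 4 := by rw [hR']; push_cast [Nat.cast_sub hP]; ring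
    have hA : 2 * R' + 1 ≤ 9 * N := by
      have hR'r : ((R' : ℕ) : ℝ) = (L : ℝ) ^ n * (R + 4) - 4 := by rw [hR']; push_cast [Nat.cast_sub hP]; ring
      have hRr : 2 * (R : ℝ) + 1 ≤ 2 * Nl := by exact_mod_cast hR
      have key : 2 * ((L : ℝ) ^ n * (R + 4) - 4) + 1 ≤ 9 * (Nl * (L : ℝ) ^ n) := by
        have h0 : 0 ≤ (L : ℝ) ^ n := by positivity
        nlinarith [mul_le_mul_of_nonneg_left hRr h0, mul_le_mul_of_nonneg_left hNlr h0]
      have : (2 * R' + 1 : ℝ) ≤ 9 * N := by rw [hR'r, hNcast]; exact key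
      exact_mod_cast this
    have h := sum_box_le_pow_mul_sum_cell_of_periodic N 9 (fun y => ∑ ν : Fin 3, ‖Xf y ν‖ ^ 2) hf0 hfp (((L : ℤ) ^ n) • c) R' hA
    rw [hcast] at h
    have h' : ∑ x ∈ box (((L : ℤ) ^ n) • c) ((L : ℤ) ^ n * (R + 4) - 4), ∑ ν : Fin 3, ‖Xf x ν‖ ^ 2 ≤ (9 : ℝ) ^ 3 * M := by
      simpa [hM] using h
    exact (hdom _ _).trans (mul_le_mul_of_nonneg_left h' hc₀)
  -- §B the Λ-part, level by level (★★ `lambda_level_sq_le`)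
  have key : ∀ i ∈ Finset.range n,
      (3 : ℕ) * (L : ℝ) * ((∏ m ∈ Finset.range i, w m) *
        ∑ z ∈ box c (R : ℤ), ∑ κ : Fin 3,
          (∑ x ∈ box (((L : ℤ) ^ n) • z) ((L : ℤ) ^ i * (L + 4) - 4), ∑ μ : Fin 3, ‖Y x μ‖ +
            ∑ x ∈ box (((L : ℤ) ^ n) • (z + e κ)) ((L : ℤ) ^ i * (L + 4) - 4), ∑ μ : Fin 3, ‖Y x μ‖))
      ≤ E * (((L : ℝ) ^ 2) ^ i)⁻¹ * cΛ *
          (V * ((L : ℝ) ^ 3) ^ (i + 1) * (((L : ℝ) ^ 3) ^ (n + 1))⁻¹ * M + V' * ((L : ℝ) ^ 2) ^ (i + 1) * G) := by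
    intro i hi
    have hin : i < n := Finset.mem_range.mp hi
    have hlev := lambda_level_sq_le rfl L hL hin Y Xf hc₀ hY N hper Nl hN c R hR
    rw [← hM, ← hG] at hlev
    have hWi : ∏ m ∈ Finset.range i, w m ≤ E * (((L : ℝ) ^ 2) ^ i)⁻¹ := hprod i hin.le
    have hWi0 : 0 ≤ ∏ m ∈ Finset.range i, w m := Finset.prod_nonneg fun m _ => hw0 m
    have hcΛ0 : 0 ≤ cΛ := le_trans (by positivity) hcΛ
    have hmono : ((L : ℝ) ^ 3) ^ (i + 1) * (((L : ℝ) ^ 3) ^ (n + 1))⁻¹ * M + 13068 * ((L : ℝ) + 4) ^ 2 * ((L : ℝ) ^ 2) ^ (i + 1) * G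
        ≤ V * ((L : ℝ) ^ 3) ^ (i + 1) * (((L : ℝ) ^ 3) ^ (n + 1))⁻¹ * M + V' * ((L : ℝ) ^ 2) ^ (i + 1) * G := by
      have hm0 : 0 ≤ ((L : ℝ) ^ 3) ^ (i + 1) * (((L : ℝ) ^ 3) ^ (n + 1))⁻¹ * M := by positivity
      have p1 : ((L : ℝ) ^ 3) ^ (i + 1) * (((L : ℝ) ^ 3) ^ (n + 1))⁻¹ * M ≤ V * ((L : ℝ) ^ 3) ^ (i + 1) * (((L : ℝ) ^ 3) ^ (n + 1))⁻¹ * M := by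
        have := mul_le_mul_of_nonneg_right hVc hm0
        linarith [this]
      have p2 : 13068 * ((L : ℝ) + 4) ^ 2 * ((L : ℝ) ^ 2) ^ (i + 1) * G ≤ V' * ((L : ℝ) ^ 2) ^ (i + 1) * G := by
        have hg : 0 ≤ ((L : ℝ) ^ 2) ^ (i + 1) * G := by positivity
        have := mul_le_mul_of_nonneg_right hV'c hg
        linarith [this]
      exact add_le_add p1 p2
    have hpre : (3 : ℕ) * (L : ℝ) * ((∏ m ∈ Finset.range i, w m) * (96 * c₀ * (2 * (L : ℝ) + 9) ^ 3))
        ≤ E * (((L : ℝ) ^ 2) ^ i)⁻¹ * cΛ := by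
      have e : (3 : ℕ) * (L : ℝ) * ((∏ m ∈ Finset.range i, w m) * (96 * c₀ * (2 * (L : ℝ) + 9) ^ 3))
          = (∏ m ∈ Finset.range i, w m) * (288 * (L : ℝ) * (2 * (L : ℝ) + 9) ^ 3 * c₀) := by push_cast; ring
      rw [e]
      have p0 : 0 ≤ 288 * (L : ℝ) * (2 * (L : ℝ) + 9) ^ 3 * c₀ := by positivity
      have q0 : 0 ≤ E * (((L : ℝ) ^ 2) ^ i)⁻¹ := mul_nonneg hE (by positivity)
      exact mul_le_mul hWi hcΛ p0 q0
    have hEc0 : 0 ≤ E * (((L : ℝ) ^ 2) ^ i)⁻¹ * cΛ := mul_nonneg (mul_nonneg hE (by positivity)) hcΛ0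
    have hm1 : 0 ≤ ((L : ℝ) ^ 3) ^ (i + 1) * (((L : ℝ) ^ 3) ^ (n + 1))⁻¹ * M + 13068 * ((L : ℝ) + 4) ^ 2 * ((L : ℝ) ^ 2) ^ (i + 1) * G := by
      positivity
    calc (3 : ℕ) * (L : ℝ) * ((∏ m ∈ Finset.range i, w m) *
          ∑ z ∈ box c (R : ℤ), ∑ κ : Fin 3,
            (∑ x ∈ box (((L : ℤ) ^ n) • z) ((L : ℤ) ^ i * (L + 4) - 4), ∑ μ : Fin 3, ‖Y x μ‖ +
              ∑ x ∈ box (((L : ℤ) ^ n) • (z + e κ)) ((L : ℤ) ^ i * (L + 4) - 4), ∑ μ : Fin 3, ‖Y x μ‖))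
        ≤ (3 : ℕ) * (L : ℝ) * ((∏ m ∈ Finset.range i, w m) * (96 * c₀ * (2 * (L : ℝ) + 9) ^ 3 *
            (((L : ℝ) ^ 3) ^ (i + 1) * (((L : ℝ) ^ 3) ^ (n + 1))⁻¹ * M + 13068 * ((L : ℝ) + 4) ^ 2 * ((L : ℝ) ^ 2) ^ (i + 1) * G))) :=
          mul_le_mul_of_nonneg_left (mul_le_mul_of_nonneg_left hlev hWi0) (by positivity)
      _ = ((3 : ℕ) * (L : ℝ) * ((∏ m ∈ Finset.range i, w m) * (96 * c₀ * (2 * (L : ℝ) + 9) ^ 3))) *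
            (((L : ℝ) ^ 3) ^ (i + 1) * (((L : ℝ) ^ 3) ^ (n + 1))⁻¹ * M + 13068 * ((L : ℝ) + 4) ^ 2 * ((L : ℝ) ^ 2) ^ (i + 1) * G) := by ring
      _ ≤ (E * (((L : ℝ) ^ 2) ^ i)⁻¹ * cΛ) *
            (V * ((L : ℝ) ^ 3) ^ (i + 1) * (((L : ℝ) ^ 3) ^ (n + 1))⁻¹ * M + V' * ((L : ℝ) ^ 2) ^ (i + 1) * G) :=
          mul_le_mul hpre hmono hm1 hEc0
  -- §C assemble
  have hS : (∏ m ∈ Finset.range n, w m) * ∑ x ∈ box (((L : ℤ) ^ n) • c) ((L : ℤ) ^ n * (R + 4) - 4), ∑ ν : Fin 3, ‖Y x ν‖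
      ≤ E * (((L : ℝ) ^ 2) ^ n)⁻¹ * cS * M := by
    have h3 : ∑ x ∈ box (((L : ℤ) ^ n) • c) ((L : ℤ) ^ n * (R + 4) - 4), ∑ ν : Fin 3, ‖Y x ν‖ ≤ cS * M := by
      calc ∑ x ∈ box (((L : ℤ) ^ n) • c) ((L : ℤ) ^ n * (R + 4) - 4), ∑ ν : Fin 3, ‖Y x ν‖ ≤ c₀ * ((9 : ℝ) ^ 3 * M) := hbig
        _ = (729 * c₀) * M := by ring
        _ ≤ cS * M := mul_le_mul_of_nonneg_right hcS hM0
    have p0 : 0 ≤ ∑ x ∈ box (((L : ℤ) ^ n) • c) ((L : ℤ) ^ n * (R + 4) - 4), ∑ ν : Fin 3, ‖Y x ν‖ :=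
      Finset.sum_nonneg fun x _ => Finset.sum_nonneg fun ν _ => norm_nonneg _
    have q0 : 0 ≤ E * (((L : ℝ) ^ 2) ^ n)⁻¹ := mul_nonneg hE (by positivity)
    calc (∏ m ∈ Finset.range n, w m) * ∑ x ∈ box (((L : ℤ) ^ n) • c) ((L : ℤ) ^ n * (R + 4) - 4), ∑ ν : Fin 3, ‖Y x ν‖
        ≤ (E * (((L : ℝ) ^ 2) ^ n)⁻¹) * (cS * M) := mul_le_mul hWn h3 p0 q0
      _ = _ := by ring
  have hΛ : (3 : ℕ) * (L : ℝ) * ∑ i ∈ Finset.range n, (∏ m ∈ Finset.range i, w m) *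
        ∑ z ∈ box c (R : ℤ), ∑ κ : Fin 3,
          (∑ x ∈ box (((L : ℤ) ^ n) • z) ((L : ℤ) ^ i * (L + 4) - 4), ∑ μ : Fin 3, ‖Y x μ‖ +
            ∑ x ∈ box (((L : ℤ) ^ n) • (z + e κ)) ((L : ℤ) ^ i * (L + 4) - 4), ∑ μ : Fin 3, ‖Y x μ‖)
      ≤ ∑ i ∈ Finset.range n, E * (((L : ℝ) ^ 2) ^ i)⁻¹ * cΛ *
          (V * ((L : ℝ) ^ 3) ^ (i + 1) * (((L : ℝ) ^ 3) ^ (n + 1))⁻¹ * M + V' * ((L : ℝ) ^ 2) ^ (i + 1) * G) := by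
    rw [Finset.mul_sum]
    exact Finset.sum_le_sum key
  exact h1.trans (add_le_add hS hΛ)

end Untied

end Summit.QuantumFields.YangMills.Theorems.Prop7CornerCombH21ELevelZeroRows

end
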